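import Summits.QuantumFields.YangMills.Theorems.BalabanLadderROTTiltCells
import Summits.QuantumFields.YangMills.Theorems.BalabanLadderROTOnClassKing
import HarnessLib

/-!
# Crux `ROT` (stmt-QuantumFields-20042): King's finite-angle defect SPLITS into a regularisation bracket and a tilt bracket

Helper file of cell `ym-beyond`, seat p4 (generation g18), `--supports stmt-QuantumFields-20042 --as helper`; companion of
`Theorems/BalabanLadderROTSkewTorus.lean` (`PeriodCell.dist`, `dist_linActMulti`) and `Theorems/BalabanLadderROTTiltCells.lean`
(`PythTriple.tiltCell`, `fittedClass`).

THE SPLIT (N-ROT-NODE-MEMO v2 §5(a), now kernel-checked).  For a family of period cells `C L` and an angle `θ`, with `R = planeRot 0 θ`,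
`A_k x = a_k x` the axis embedding and `LD_k` the tree's `latticeDist` at step `k` of a scheme,
  `LD_k(R·F) − LD_k(F) = [LD_k(R·F) − (C L_k).dist_{R∘A_k}(R·F)] + [(C L_k).dist_{A_k}(F) − LD_k(F)]`
EXACTLY, because `(C L_k).dist_{R∘A_k}(R·F) = (C L_k).dist_{A_k}(F)` (`PeriodCell.dist_linActMulti`; no reindexing of sites).  With
`C = t.tiltCell` for a Pythagorean triple `t` of angle `θ` on the fitted class (`q ∣ 2L+1`), bracket 1 compares TWO REGULARISATIONS
(axis lattice `aℤ⁴` vs tilted lattice `R(aℤ⁴)`) of the SAME straight torus `ℝ⁴/a(2L+1)ℤ⁴` on the same test function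
(`PythTriple.planeRot_smul_siteToE_tiltCell_period`: the tilted cell's periods rotate onto `a(2L+1)ℤ⁴`) — C. King's two-orientation
comparison proper (CMP **103** (1986) Thm 2.4 / II (2.24), `D_J` vs `D_{J'}` on one torus `Λ`) = leg-1 node N-ROT.3 in `latticeDist`
currency; bracket 2 compares the axis lattice on the TILTED torus `ℝ⁴/R⁻¹(a(2L+1)ℤ⁴)` with the axis lattice on the straight torus —
the tilt insensitivity `TI` of caveat (iii′) (King II (2.25)), a finite-volume-SHAPE statement.

Typed here, with EXACTLY the binders of `LatticeKingWardOn` (ClassDefs §3):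
* `TiltedRegComparisonOn G r a C θ S` (bracket 1 → 0 on King's class along admissible schemes with tori in `S`);
* `TiltInsensitivityOn G r a C S` (bracket 2 → 0 likewise);
* `latticeKingWardOn_of_tilt : TiltedRegComparisonOn … C θ S → TiltInsensitivityOn … C S → LatticeKingWardOn G r a {θ} S` (PROVED);
* the guarded `∀ G` wrappers `NROT3 C θ S`, `TI C S` (guards `MomentBounds6`, `GapInUnits`, as in `KingOnClass`) and
  `kingOnClass_of_tilt : UnboundedClass S → Irrational (θ/2π) → NROT3 C θ S → TI C S → KingOnClass` (PROVED), instantiated at King's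
  `(4,3,5)`, `θ = arcsin (3/5)`, `S = fittedClass 5` (`kingOnClass_of_tilt345`) and at the Bałaban-admissible `(12,5,13)`,
  `θ = arcsin (5/13)`, `S = fittedClass 13` (`kingOnClass_of_tilt51213`); with `Theorems.ROT.rot2'_of_kingOnClass` each pair of halves
  gives `ROT` rev 2′ (`rot2'_of_tilt345`).

So the XXL candidate stub `KingOnClass` is the conjunction of two typed, separately attackable statements: N-ROT.3 (a UV/universality
statement on a common torus — leg 1's currency, README §3 coupling) and TI (IR).  WHAT THIS IS NOT: no claim about Yang–Mills; neither half
is asserted; the split with the WRONG cell (e.g. the axis cell) degenerates into KING at angle `−θ` (costume) — its content is exactly the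
pinning of `C` to the tilted torus, certified by `planeRot_smul_siteToE_tiltCell_period`.  No instance, no named fact, no sorry.
-/

set_option autoImplicit false

noncomputable section

open scoped SchwartzMap
open MeasureTheory Filter Topology Real
open Literature.MathematicalPhysics.QuantumFieldTheory Literature.MathematicalPhysics.QuantumLattice
open Literature.MathematicalPhysics.AQFT Literature.Probability.LatticeModels
open Summit.QuantumFields.YangMills.Cruxes.OSLegsFromFemtoAndGap.DlrCollarTransfer
open Summit.QuantumFields.YangMills.Cruxes.OSLegsAtWeakCouplingC.Sketch
open Summit.QuantumFields.YangMills.Cruxes.OSLegsAtWeakCouplingC.Y2Bridge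
open Summit.QuantumFields.YangMills.Theorems.OSLegsFromFemtoAndGap (latticeDist)
open Summit.QuantumFields.YangMills.Theorems.NPointIsotropy.Negative (E4)

namespace Summit.QuantumFields.YangMills.Theorems.ROT

/-! ## §1 The two brackets, typed with the binders of `LatticeKingWardOn` -/

section Binder

variable (G : Type) [Group G] [TopologicalSpace G] [IsTopologicalGroup G] [CompactSpace G]
  [MeasurableSpace G] [BorelSpace G] (r : LatticeRep G) (a : ℝ → ℝ)

/-- **`TiltedRegComparisonOn C θ S` (N-ROT.3 on a class, `latticeDist` currency)**: along every admissible scheme in units `a` with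
torus half-sides in `S` there is `r₀ > 0` such that on King's class of diameter `< r₀` the centred `n`-point distribution of the action
density of the AXIS lattice (`latticeDist`) and that of the lattice embedded by `x ↦ R_θ(a x)` and periodised by the cell `C L`
(`(C L).dist`; for `C = t.tiltCell` on the fitted class: the tilted lattice `R_θ(aℤ⁴)` on the SAME straight torus) agree in the limit,
on the same test function. -/
def TiltedRegComparisonOn (C : ℕ → PeriodCell 4) (θ : ℝ) (S : Set ℕ) : Prop :=
  ∀ (sch : SpeciesScheme (YMSpecies G)), (∀ k, sch.L k ∈ S) → (∀ k, sch.a k = a (sch.β k)) →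
    Tendsto sch.β atTop atTop →
    (∀ k, 0 ≤ sch.β k ∧ sch.a k ≤ 1 / 24 ∧ 14 ≤ sch.L k ∧ (sch.a k)⁻¹ * (sch.a k)⁻¹ ≤ sch.L k) →
      ∃ r₀ : ℝ, 0 < r₀ ∧ ∀ (n : ℕ), 2 ≤ n → ∀ F ∈ King.KingClass n r₀,
        Tendsto (fun k =>
          latticeDist r.ρ (sch.β k) (sch.L k) (sch.a k) r.curvature.F
              (wilsonTorusMean r.ρ (sch.β k) (sch.L k) r.curvature.F) n F -
            (C (sch.L k)).dist r.ρ (sch.β k) (fun x => planeRot (0 : Fin 3) θ (sch.a k • siteToE x)) r.curvature.F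
              ((C (sch.L k)).mean r.ρ (sch.β k) r.curvature.F) n F) atTop (𝓝 0)

/-- **`TiltInsensitivityOn C S` (TI on a class)**: along every admissible scheme in units `a` with torus half-sides in `S` there is
`r₀ > 0` such that on King's class of diameter `< r₀` the centred `n`-point distribution of the action density of the axis lattice
periodised by the cell `C L` (for `C = t.tiltCell` on the fitted class: the axis lattice on the TILTED torus `ℝ⁴/R_θ⁻¹(a(2L+1)ℤ⁴)`) and
that of the axis lattice on the straight torus (`latticeDist`) agree in the limit. -/
def TiltInsensitivityOn (C : ℕ → PeriodCell 4) (S : Set ℕ) : Prop :=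
  ∀ (sch : SpeciesScheme (YMSpecies G)), (∀ k, sch.L k ∈ S) → (∀ k, sch.a k = a (sch.β k)) →
    Tendsto sch.β atTop atTop →
    (∀ k, 0 ≤ sch.β k ∧ sch.a k ≤ 1 / 24 ∧ 14 ≤ sch.L k ∧ (sch.a k)⁻¹ * (sch.a k)⁻¹ ≤ sch.L k) →
      ∃ r₀ : ℝ, 0 < r₀ ∧ ∀ (n : ℕ), 2 ≤ n → ∀ F ∈ King.KingClass n r₀,
        Tendsto (fun k =>
          (C (sch.L k)).dist r.ρ (sch.β k) (fun x => sch.a k • siteToE x) r.curvature.F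
              ((C (sch.L k)).mean r.ρ (sch.β k) r.curvature.F) n F -
            latticeDist r.ρ (sch.β k) (sch.L k) (sch.a k) r.curvature.F
              (wilsonTorusMean r.ρ (sch.β k) (sch.L k) r.curvature.F) n F) atTop (𝓝 0)

end Binder

/-! ## §2 The split -/

/-- King's class shrinks with the diameter bound. -/
theorem kingClass_mono {n : ℕ} {r₁ r₂ : ℝ} (h : r₁ ≤ r₂) : King.KingClass n r₁ ⊆ King.KingClass n r₂ := by
  rintro F ⟨hFo, hFc, hδ, hFr⟩
  exact ⟨hFo, hFc, hδ, hFr.trans fun x hx i j => lt_of_lt_of_le (hx i j) h⟩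

section Split

variable {G : Type} [Group G] [TopologicalSpace G] [IsTopologicalGroup G] [CompactSpace G]
  [MeasurableSpace G] [BorelSpace G]

/-- **The exact split of King's finite-angle defect** at one step: for every period cell `C`, angle `θ`, spacing `a` and test
function `F`, `LD(R·F) − LD(F) = [LD(R·F) − C.dist_{R∘A}(R·F)] + [C.dist_A(F) − LD(F)]` — the covariance `PeriodCell.dist_linActMulti`
identifies the two middle terms. -/
theorem kingDefect_eq_brackets (C : PeriodCell 4) (r : LatticeRep G) (β : ℝ) (L : ℕ) (a θ : ℝ) {n : ℕ} (F : 𝓢((Fin n → E4), ℂ)) :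
    latticeDist r.ρ β L a r.curvature.F (wilsonTorusMean r.ρ β L r.curvature.F) n (linActMulti (planeRot (0 : Fin 3) θ) F) -
        latticeDist r.ρ β L a r.curvature.F (wilsonTorusMean r.ρ β L r.curvature.F) n F =
      (latticeDist r.ρ β L a r.curvature.F (wilsonTorusMean r.ρ β L r.curvature.F) n (linActMulti (planeRot (0 : Fin 3) θ) F) -
          C.dist r.ρ β (fun x => planeRot (0 : Fin 3) θ (a • siteToE x)) r.curvature.F (C.mean r.ρ β r.curvature.F) n
            (linActMulti (planeRot (0 : Fin 3) θ) F)) +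
        (C.dist r.ρ β (fun x => a • siteToE x) r.curvature.F (C.mean r.ρ β r.curvature.F) n F -
          latticeDist r.ρ β L a r.curvature.F (wilsonTorusMean r.ρ β L r.curvature.F) n F) := by
  have hcov := C.dist_linActMulti r.ρ β (fun x => a • siteToE x) r.curvature.F (C.mean r.ρ β r.curvature.F) n
    (planeRot (0 : Fin 3) θ) F
  linear_combination hcov

/-- **`TiltedRegComparisonOn ∧ TiltInsensitivityOn ⇒ LatticeKingWardOn` at the single angle `θ`** (the split, summed along the
scheme): King's class is stable under `R_θ` (`King.linActMulti_mem_kingClass`), so bracket 1 applies to `R·F`; the two brackets add up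
to King's defect exactly (`kingDefect_eq_brackets`). -/
theorem latticeKingWardOn_of_tilt (r : LatticeRep G) (a : ℝ → ℝ) (C : ℕ → PeriodCell 4) (θ : ℝ) (S : Set ℕ)
    (hRC : TiltedRegComparisonOn G r a C θ S) (hTI : TiltInsensitivityOn G r a C S) :
    LatticeKingWardOn G r a ({θ} : Set ℝ) S := by
  intro sch hS hunits hβ hranges
  obtain ⟨r₁, hr₁, h1⟩ := hRC sch hS hunits hβ hranges
  obtain ⟨r₂, hr₂, h2⟩ := hTI sch hS hunits hβ hranges
  refine ⟨min r₁ r₂, lt_min hr₁ hr₂, fun n hn F hF θ' hθ' => ?_⟩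
  rw [Set.mem_singleton_iff] at hθ'
  subst hθ'
  have hF₁ : F ∈ King.KingClass n r₁ := kingClass_mono (min_le_left _ _) hF
  have hF₂ : F ∈ King.KingClass n r₂ := kingClass_mono (min_le_right _ _) hF
  have t1 := h1 n hn _ (King.linActMulti_mem_kingClass hF₁ (planeRot (0 : Fin 3) θ'))
  have t2 := h2 n hn F hF₂
  have t12 := t1.add t2
  rw [add_zero] at t12
  refine t12.congr fun k => ?_
  exact (kingDefect_eq_brackets (C (sch.L k)) r (sch.β k) (sch.L k) (sch.a k) θ' F).symm

/-- … hence, with UV sequential compactness at `(G, r, a)` and `θ / 2π` irrational, the rotation-Ward leg on the class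
(`latticeRotWardOn_of_uvCompactAt_of_latticeKingWardOn_single`). -/
theorem latticeRotWardOn_of_tilt (r : LatticeRep G) (a : ℝ → ℝ) (hX : UVCompactAt r a) (C : ℕ → PeriodCell 4) {θ : ℝ}
    (hθ : Irrational (θ / (2 * π))) (S : Set ℕ) (hRC : TiltedRegComparisonOn G r a C θ S) (hTI : TiltInsensitivityOn G r a C S) :
    LatticeRotWardOn G r a S :=
  latticeRotWardOn_of_uvCompactAt_of_latticeKingWardOn_single r a hX hθ (latticeKingWardOn_of_tilt r a C θ S hRC hTI)

end Split

/-! ## §3 The two halves of the candidate stub `KingOnClass`, guarded as it is -/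

/-- **N-ROT.3 (guarded)**: for every compact simple `G`, `r`, positive unit map `a → 0` carrying `MomentBounds6` and `GapInUnits`, the
regularisation bracket vanishes on `(C, θ, S)`.  (UV renormalisation + volume-uniform locality on the common straight tori of the class;
C. King, CMP 103 (1986) Thm 2.4 / II Thm 4.2 for the `(4,3,5)` pair — unprinted for YM₄ at this generality; Bałaban's flow for an
R-oriented hypercubic lattice is the identical flow in rotated coordinates, the comparison map between the two last-scale actions on the
common torus is the unprinted piece, N-ROT-NODE-MEMO v2 §3–4.)  Nothing asserted. -/
def NROT3 (C : ℕ → PeriodCell 4) (θ : ℝ) (S : Set ℕ) : Prop :=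
  ∀ (G : Type) [Group G] [TopologicalSpace G] [IsTopologicalGroup G] [CompactSpace G],
    IsCompactSimpleLieGroup G → letI : MeasurableSpace G := borel G; haveI : BorelSpace G := ⟨rfl⟩;
    ∀ (r : LatticeRep G) (a : ℝ → ℝ), (∀ β, 0 < a β) → Tendsto a atTop (𝓝 0) → MomentBounds6 G r a →
      GapInUnits G r a → TiltedRegComparisonOn G r a C θ S

/-- **TI (guarded)**: for every compact simple `G`, `r`, positive unit map `a → 0` carrying `MomentBounds6` and `GapInUnits`, the tilt
bracket vanishes on `(C, S)` — insensitivity of the germ of the axis theory's `n`-point functions to the SHAPE (straight vs tilted) of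
the diverging tori (King II (2.25); an infrared statement: exponential clustering uniform in the volume would give it).  Nothing
asserted. -/
def TI (C : ℕ → PeriodCell 4) (S : Set ℕ) : Prop :=
  ∀ (G : Type) [Group G] [TopologicalSpace G] [IsTopologicalGroup G] [CompactSpace G],
    IsCompactSimpleLieGroup G → letI : MeasurableSpace G := borel G; haveI : BorelSpace G := ⟨rfl⟩;
    ∀ (r : LatticeRep G) (a : ℝ → ℝ), (∀ β, 0 < a β) → Tendsto a atTop (𝓝 0) → MomentBounds6 G r a →
      GapInUnits G r a → TiltInsensitivityOn G r a C S

/-- **`KingOnClass ⇐ N-ROT.3 ∧ TI`** on an unbounded class at an irrational-over-`2π` angle. -/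
theorem kingOnClass_of_tilt (C : ℕ → PeriodCell 4) {θ : ℝ} {S : Set ℕ} (hS : UnboundedClass S)
    (hθ : Irrational (θ / (2 * π))) (h3 : NROT3 C θ S) (hT : TI C S) : KingOnClass := by
  intro G _ _ _ _ hG
  letI : MeasurableSpace G := borel G
  haveI : BorelSpace G := ⟨rfl⟩
  intro r a ha ha0 hUV hIR
  exact ⟨S, hS, θ, hθ, latticeKingWardOn_of_tilt r a C θ S (h3 G hG r a ha ha0 hUV hIR) (hT G hG r a ha ha0 hUV hIR)⟩

/-! ## §4 Instances: King's `(4,3,5)` on `5 ∣ 2L+1`, and the Bałaban-admissible `(12,5,13)` on `13 ∣ 2L+1` -/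

open PythTriple

/-- **King's data**: `KingOnClass ⇐ N-ROT.3 ∧ TI` for the tilt cells of `(4,3,5)` at `θ = arcsin (3/5)` on the fitted class of `5`. -/
theorem kingOnClass_of_tilt345 (h3 : NROT3 king345.tiltCell (Real.arcsin (3 / 5)) (fittedClass 5))
    (hT : TI king345.tiltCell (fittedClass 5)) : KingOnClass :=
  kingOnClass_of_tilt king345.tiltCell (unboundedClass_fittedClass odd_five) irrational_arcsin_three_fifths_div_two_pi h3 hT

/-- **Bałaban-admissible data**: `KingOnClass ⇐ N-ROT.3 ∧ TI` for the tilt cells of `(12,5,13)` at `θ = arcsin (5/13)` on the fitted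
class of `13` (odd block factor `13 > 11`, so Track A's `T4Family` at `L = 13` lives on this class; N-ROT-NODE-MEMO v2 §2). -/
theorem kingOnClass_of_tilt51213 (h3 : NROT3 bal51213.tiltCell (Real.arcsin (5 / 13)) (fittedClass 13))
    (hT : TI bal51213.tiltCell (fittedClass 13)) : KingOnClass :=
  kingOnClass_of_tilt bal51213.tiltCell (unboundedClass_fittedClass odd_thirteen)
    PythTriple.irrational_arcsin_five_thirteenths_div_two_pi h3 hT

/-- **`ROT` rev 2′ ⇐ N-ROT.3 ∧ TI (King's data)**, by `Theorems.ROT.rot2'_of_kingOnClass` (compactness from the PROVED `stub_uvExtract`). -/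
theorem rot2'_of_tilt345 (h3 : NROT3 king345.tiltCell (Real.arcsin (3 / 5)) (fittedClass 5))
    (hT : TI king345.tiltCell (fittedClass 5)) :
    ∀ (G : Type) [Group G] [TopologicalSpace G] [IsTopologicalGroup G] [CompactSpace G],
      IsCompactSimpleLieGroup G → letI : MeasurableSpace G := borel G; haveI : BorelSpace G := ⟨rfl⟩;
      ∀ (r : LatticeRep G) (a : ℝ → ℝ), (∀ β, 0 < a β) → Tendsto a atTop (𝓝 0) →
        LowerBounds G r a → MomentBounds6 G r a → GapInUnits G r a →
          ∃ S : Set ℕ, UnboundedClass S ∧ LatticeRotWardOn G r a S :=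
  rot2'_of_kingOnClass (kingOnClass_of_tilt345 h3 hT)

/-! ## §5 The geometric certificates at the two data (what the cells ARE on their classes) -/

/-- On the fitted class of `5`, the periods of King's tilt cell rotate by `arcsin (3/5)` onto the straight torus lattice
`a(2L+1)ℤ⁴` of `latticeDist … L a …`. -/
theorem tiltCell345_period {L : ℕ} (hL : L ∈ fittedClass 5) (a : ℝ) {x : Site 4} (hx : x ∈ (king345.tiltCell L).P) :
    ∃ z : Site 4, planeRot (0 : Fin 3) (Real.arcsin (3 / 5)) (a • siteToE x) = (a * (2 * L + 1 : ℕ)) • siteToE z :=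
  king345.planeRot_smul_siteToE_tiltCell_period _ king345_cos king345_sin hL a hx

/-- The same for `(12,5,13)` at `arcsin (5/13)` on the fitted class of `13`. -/
theorem tiltCell51213_period {L : ℕ} (hL : L ∈ fittedClass 13) (a : ℝ) {x : Site 4} (hx : x ∈ (bal51213.tiltCell L).P) :
    ∃ z : Site 4, planeRot (0 : Fin 3) (Real.arcsin (5 / 13)) (a • siteToE x) = (a * (2 * L + 1 : ℕ)) • siteToE z :=
  bal51213.planeRot_smul_siteToE_tiltCell_period _ bal51213_cos bal51213_sin hL a hx

end Summit.QuantumFields.YangMills.Theorems.ROT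

end
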